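import Literature.Probability.LatticeModels.SixVertexTwoPointTheorem

/-!
# Six-vertex model: Theorem 23, the corner `x₂ = 0` with arbitrary gap `x₁' ≥ 0` (DKLM 2026)

H. Duminil-Copin, K. K. Kozlowski, P. Lammers, I. Manolescu, *Gaussian free field convergence of
the six-vertex model with `-1 ≤ Δ ≤ -1/2`*, arXiv:2603.06268 (2026) [DKLM2026SixVertexGFF]
(`paper:arxiv-2603.06268`, chunks p0018–p0019):

> We say that a sequence `(u₁,u₁',…,u_{2k},u_{2k}')` is *horizontally ordered* whenever
> `x_i, x_i' ≥ 0` for all `i` […] **Theorem 23** […] for any horizontally ordered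
> `u = (u₁,u₁',u₂,u₂') ⊂ ℤ²`.

In `SixVertexTwoPointTheorem.lean` a purely vertical pair `h(v + (0,q)) - h(v)` is read through the
east edges of the column to the left of the face `v` (`colObs`), which places `v` at a face
`s + 1 ≥ 1` of its strip and hence forces `x₁' ≥ 1` when the *second* pair is vertical. Here the
vertical pair is written instead along the path east–north–west,
`h(v+(0,q)) - h(v) = [h(v+(1,q)) - h(v)] - [h(v+(1,q)) - h(v+(0,q))]` (`vertObs`, a difference of
two L-observables based at the face `v` itself; the two readings agree on ice configurations by
path independence, Def. 2.3), so that `v` may be the first face of its strip and the gap `x₁'` may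
vanish (`u₂ = u₁'`). With it, formula (eq:thm23) holds for the remaining horizontally ordered
configurations:

* `cylinderPairExp_lPairObs_vertObs_eq_sum` / `_eq_integral` — pair 1 L-shaped (`x₁ ≥ 1`), pair 2
  vertical at gap `x₁' = (r₁' - a₁ - w₁') + k + a₂ ≥ 0`;
* `cylinderPairExp_colObs_vertObs_eq_sum` / `_eq_integral` — both pairs vertical, gap
  `x₁' = (r₁' - s₁) + k + a₂ ≥ 0`.

Vertical displacements `q` enter only modulo `L` (`torusObs_colObs_add_period`,
`cylinderPairExp_add_period_left/right`: on balanced configurations every column of horizontal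
arrows has zero total sign), so southward displacements `-q'` are covered as `q = L - q'`.

## References

* H. Duminil-Copin, K. K. Kozlowski, P. Lammers, I. Manolescu, arXiv:2603.06268 (2026), Theorem 23
  and Def. 2.3. [DKLM2026SixVertexGFF]
-/

noncomputable section

open Finset MeasureTheory

namespace Literature.Probability.LatticeModels.SixVertex

/-! ## 1. The vertical pair based at an arbitrary face of a strip -/

section Obs

variable {G₂ : Type*} [AddCommGroup G₂] [One G₂] [Fintype G₂] [DecidableEq G₂]

/-- **The vertical pair `h(v + (0,q)) - h(v)` based at the face `a` of a strip**, written along the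
path east–north–west: `[h(v+(1,q)) - h(v)] - [h(v+(1,q)) - h(v+(0,q))]`, a difference of two
L-observables (the second with no vertical leg, at the row `y + q`).
[cite: DKLM2026SixVertexGFF, Def. 2.3 and Theorem 23] -/
def vertObs (r' a : ℕ) (h : a + 0 + 1 ≤ r' + 1) (q : ℕ) (y : G₂) :
    (G₂ → Bool) → (Fin (r' + 1) → G₂ → Bool) → (Fin (r' + 1) → G₂ → Bool) → ℝ :=
  lPairObs r' a 0 h q y - lPairObs r' a 0 h 0 (y + q • (1 : G₂))

omit [Fintype G₂] [DecidableEq G₂] in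
/-- **The two readings of a vertical pair agree on ice configurations** (path independence,
Def. 2.3): at a face `a' + 1 ≥ 1` of the strip, `vertObs` (path east–north–west) and `colObs`
(straight north, through the east edges of column `a'`) take the same value whenever the ice rule
holds at the vertices `(a'+1, y+1), …, (a'+1, y+q)`. [cite: DKLM2026SixVertexGFF, Def. 2.3] -/
theorem torusObs_vertObs_eq_colObs_of_ice {M : ℕ} (r' a' : ℕ) (h : a' + 1 + 0 + 1 ≤ r' + 1) (q : ℕ) (y : G₂)
    (ω : Config (ZMod M × G₂))
    (hice : ∀ m : ℕ, m < q → IceRuleAt ω ((((a' + 1 : ℕ) : ZMod M)), y + (m + 1) • (1 : G₂))) :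
    torusObs r' (vertObs r' (a' + 1) h q y) ω = torusObs r' (colObs r' ⟨a', by omega⟩ q y) ω := by
  have hpi := rect_path_independence ω (((a' : ℕ) : ZMod M)) y 1 q (fun s m hs hm => by
    have hs0 : s = 0 := by omega
    subst hs0
    simpa [Nat.cast_succ] using hice m hm)
  simp only [Finset.sum_range_one, zero_add, one_smul] at hpi
  have hcast : ((a' : ℕ) : ZMod M) + 1 = ((a' + 1 : ℕ) : ZMod M) := by push_cast; ring
  rw [hcast] at hpi
  have hsub : torusObs r' (vertObs r' (a' + 1) h q y) ω =
      torusObs r' (lPairObs r' (a' + 1) 0 h q y) ω - torusObs r' (lPairObs r' (a' + 1) 0 h 0 (y + q • (1 : G₂))) ω := rfl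
  rw [hsub, torusObs_lPairObs, torusObs_lPairObs, torusObs_colObs]
  simp only [Fin.sum_univ_succ, Fin.sum_univ_zero, Fin.val_zero, add_zero, Finset.sum_range_zero]
  linarith

end Obs

/-! ## 2. Vertical displacements are read modulo `L` -/

section Periodic

variable {G₁ G₂ : Type*} [AddGroup G₁] [AddGroup G₂] [One G₁] [One G₂] [Fintype G₁] [Fintype G₂]
  [DecidableEq G₁] [DecidableEq G₂]

/-- `𝔼_{𝕋}[F | balanced] = 𝔼_{𝕋}[G | balanced]` whenever `F = G` on balanced configurations.
[cite: DKLM2026SixVertexGFF, Def. 2.2] -/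
theorem torusCondExp_congr_of_isBalanced (a b c : ℝ) {F G : Config (G₁ × G₂) → ℝ}
    (h : ∀ ω, IsBalanced ω → F ω = G ω) : torusCondExp a b c F = torusCondExp a b c G := by
  unfold torusCondExp
  congr 1
  refine Finset.sum_congr rfl fun ω _ => ?_
  split_ifs with hb
  · rw [h ω hb]
  · rfl

omit [AddGroup G₁] [AddGroup G₂] [One G₁] [One G₂] [Fintype G₁] [DecidableEq G₁] [DecidableEq G₂] in
/-- **On a balanced configuration every column of horizontal arrows has zero total sign**:
`∑_y ±1 = #east - #west = 0`. [cite: DKLM2026SixVertexGFF, Def. 2.2] -/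
theorem sum_arrowSign_fst_eq_zero (ω : Config (G₁ × G₂)) (hω : IsBalanced ω) (x : G₁) :
    ∑ y, arrowSign (ω (x, y)).1 = 0 := by
  have h2 := hω x
  have hsplit : ∀ y : G₂, arrowSign (ω (x, y)).1 = 2 * (if (ω (x, y)).1 = true then (1 : ℝ) else 0) - 1 := by
    intro y
    unfold arrowSign
    split_ifs <;> norm_num
  rw [Finset.sum_congr rfl fun y _ => hsplit y, Finset.sum_sub_distrib, ← Finset.mul_sum, Finset.sum_boole,
    Finset.sum_const, Finset.card_univ, nsmul_eq_mul, mul_one]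
  have : (2 : ℝ) * ((Finset.univ.filter fun y : G₂ => (ω (x, y)).1 = true).card : ℝ) = (Fintype.card G₂ : ℝ) := by
    exact_mod_cast h2
  rw [this, sub_self]

/-- A full period of rows, started anywhere, enumerates `ℤ/Lℤ`. [folklore] -/
theorem sum_range_period_eq_sum_univ (n : ℕ) (g : ZMod (n + 1) → ℝ) (y₀ : ZMod (n + 1)) (q : ℕ) :
    ∑ m ∈ Finset.range (n + 1), g (y₀ + (q + m + 1) • (1 : ZMod (n + 1))) = ∑ z, g z := by
  rw [Finset.sum_range]
  have hre : ∀ i : Fin (n + 1), g (y₀ + (q + (i : ℕ) + 1) • (1 : ZMod (n + 1))) =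
      (fun z : ZMod (n + 1) => g (y₀ + (q : ZMod (n + 1)) + 1 + z)) (i : ZMod (n + 1)) := by
    intro i
    have hi : (((i : ℕ) : ℕ) : ZMod (n + 1)) = (i : ZMod (n + 1)) := by
      exact ZMod.natCast_zmod_val (show ZMod (n + 1) from i)
    simp only [Nat.smul_one_eq_cast, Nat.cast_add, Nat.cast_one, hi]
    congr 1
    abel
  rw [Fintype.sum_congr _ _ hre]
  exact Equiv.sum_comp (Equiv.addLeft (y₀ + (q : ZMod (n + 1)) + 1)) g

/-- **Vertical displacements are read modulo `L`** (`colObs`): on a balanced configuration,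
going north `L = |ℤ/Lℤ|` further steps adds the total sign of a column of horizontal arrows, which
vanishes; hence `q` and `q + L` define the same observable in every `𝔼_{𝕋}[· | balanced]`, and a
southward displacement `-q'` is represented by `q = L - q'`. [cite: DKLM2026SixVertexGFF, Def. 2.2–2.3] -/
theorem torusObs_colObs_add_period {M n : ℕ} [NeZero M] (r' : ℕ) (s : Fin (r' + 1)) (q : ℕ) (y₀ : ZMod (n + 1))
    (ω : Config (ZMod M × ZMod (n + 1))) (hω : IsBalanced ω) :
    torusObs r' (colObs r' s (q + (n + 1)) y₀) ω = torusObs r' (colObs r' s q y₀) ω := by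
  rw [torusObs_colObs, torusObs_colObs, Finset.sum_range_add]
  have h := sum_range_period_eq_sum_univ n (fun z => arrowSign (ω ((((s : ℕ) : ℕ) : ZMod M), z)).1) y₀ q
  rw [show (∑ m ∈ Finset.range (n + 1), arrowSign (ω ((((s : ℕ) : ℕ) : ZMod M), y₀ + (q + m + 1) • (1 : ZMod (n + 1)))).1) =
      ∑ z, arrowSign (ω ((((s : ℕ) : ℕ) : ZMod M), z)).1 from h, sum_arrowSign_fst_eq_zero ω hω, add_zero]

/-- The same for the vertical leg of an L-observable. [cite: DKLM2026SixVertexGFF, Def. 2.2–2.3] -/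
theorem torusObs_lPairObs_add_period {M n : ℕ} [NeZero M] (r' a w' : ℕ) (h : a + w' + 1 ≤ r' + 1) (q : ℕ) (y₀ : ZMod (n + 1))
    (ω : Config (ZMod M × ZMod (n + 1))) (hω : IsBalanced ω) :
    torusObs r' (lPairObs r' a w' h (q + (n + 1)) y₀) ω = torusObs r' (lPairObs r' a w' h q y₀) ω := by
  rw [torusObs_lPairObs, torusObs_lPairObs, Finset.sum_range_add]
  have h := sum_range_period_eq_sum_univ n (fun z => arrowSign (ω ((((a + w' : ℕ) : ℕ) : ZMod M), z)).1) y₀ q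
  rw [show (∑ m ∈ Finset.range (n + 1), arrowSign (ω ((((a + w' : ℕ) : ℕ) : ZMod M), y₀ + (q + m + 1) • (1 : ZMod (n + 1)))).1) =
      ∑ z, arrowSign (ω ((((a + w' : ℕ) : ℕ) : ZMod M), z)).1 from h, sum_arrowSign_fst_eq_zero ω hω, add_zero]

/-- **Periodicity in the pair correlations, first slot.** [cite: DKLM2026SixVertexGFF, Def. 2.2–2.3] -/
theorem cylinderPairExp_add_period_left (c : ℝ) {n r₁' r₂' : ℕ}
    (X : ℕ → (ZMod (n + 1) → Bool) → (Fin (r₁' + 1) → ZMod (n + 1) → Bool) → (Fin (r₁' + 1) → ZMod (n + 1) → Bool) → ℝ)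
    (hX : ∀ (M : ℕ) [NeZero M] (ω : Config (ZMod M × ZMod (n + 1))), IsBalanced ω →
      ∀ q, torusObs r₁' (X (q + (n + 1))) ω = torusObs r₁' (X q) ω)
    (q k : ℕ) (Y : (ZMod (n + 1) → Bool) → (Fin (r₂' + 1) → ZMod (n + 1) → Bool) → (Fin (r₂' + 1) → ZMod (n + 1) → Bool) → ℝ) :
    cylinderPairExp c r₁' (X (q + (n + 1))) k r₂' Y = cylinderPairExp c r₁' (X q) k r₂' Y := by
  refine cylinderPairExp_congr c fun M => ?_
  unfold torusPairExp
  split_ifs with hM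
  · rfl
  · haveI : NeZero M := ⟨hM⟩
    exact torusCondExp_congr_of_isBalanced 1 1 c fun ω hω => by
      unfold torusPairObs
      rw [hX M ω hω q]

/-- **Periodicity in the pair correlations, second slot.** [cite: DKLM2026SixVertexGFF, Def. 2.2–2.3] -/
theorem cylinderPairExp_add_period_right (c : ℝ) {n r₁' r₂' : ℕ}
    (X : (ZMod (n + 1) → Bool) → (Fin (r₁' + 1) → ZMod (n + 1) → Bool) → (Fin (r₁' + 1) → ZMod (n + 1) → Bool) → ℝ) (k : ℕ)
    (Y : ℕ → (ZMod (n + 1) → Bool) → (Fin (r₂' + 1) → ZMod (n + 1) → Bool) → (Fin (r₂' + 1) → ZMod (n + 1) → Bool) → ℝ)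
    (hY : ∀ (M : ℕ) [NeZero M] (ω : Config (ZMod M × ZMod (n + 1))), IsBalanced ω →
      ∀ q, torusObs r₂' (Y (q + (n + 1))) ω = torusObs r₂' (Y q) ω)
    (q : ℕ) :
    cylinderPairExp c r₁' X k r₂' (Y (q + (n + 1))) = cylinderPairExp c r₁' X k r₂' (Y q) := by
  refine cylinderPairExp_congr c fun M => ?_
  unfold torusPairExp
  split_ifs with hM
  · rfl
  · haveI : NeZero M := ⟨hM⟩
    exact torusCondExp_congr_of_isBalanced 1 1 c fun ω hω => by
      unfold torusPairObs
      rw [hY M _ ((isBalanced_shift_iff ω _).2 hω) q]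

/-- `vertObs` is `L`-periodic in `q` on balanced configurations as well. [cite: DKLM2026SixVertexGFF, Def. 2.2–2.3] -/
theorem torusObs_vertObs_add_period {M n : ℕ} [NeZero M] (r' a : ℕ) (h : a + 0 + 1 ≤ r' + 1) (q : ℕ) (y₀ : ZMod (n + 1))
    (ω : Config (ZMod M × ZMod (n + 1))) (hω : IsBalanced ω) :
    torusObs r' (vertObs r' a h (q + (n + 1)) y₀) ω = torusObs r' (vertObs r' a h q y₀) ω := by
  have hper : y₀ + (q + (n + 1)) • (1 : ZMod (n + 1)) = y₀ + q • (1 : ZMod (n + 1)) := by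
    rw [add_smul, Nat.smul_one_eq_cast (n + 1), ZMod.natCast_self, add_zero]
  show torusObs r' (lPairObs r' a 0 h (q + (n + 1)) y₀) ω - torusObs r' (lPairObs r' a 0 h 0 (y₀ + (q + (n + 1)) • (1 : ZMod (n + 1)))) ω =
    torusObs r' (lPairObs r' a 0 h q y₀) ω - torusObs r' (lPairObs r' a 0 h 0 (y₀ + q • (1 : ZMod (n + 1)))) ω
  rw [torusObs_lPairObs_add_period r' a 0 h q y₀ ω hω, hper]

end Periodic

/-! ## 3. Theorem 23 with a vertical second pair at gap `x₁' ≥ 0` -/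

section Formula

variable (c : ℝ) (hc : 0 < c) (ℓ : ℕ)

/-- Rows: `y + q • 1 = (y + q : ℕ)` in `ℤ/Lℤ`. [folklore] -/
theorem natCast_add_nsmul_one (L y q : ℕ) : ((y : ℕ) : ZMod L) + q • (1 : ZMod L) = ((y + q : ℕ) : ZMod L) := by
  rw [Nat.cast_add, Nat.smul_one_eq_cast]

include hc

/-- **Theorem 23, pair 1 L-shaped, pair 2 vertical at gap `x₁' ≥ 0`** (spectral sum):
`Φ = ∑_k w_k (ω̄_k^{y₂+q₂} - ω̄_k^{y₂}) (1-a_k)^{x₁'} (ω_k^{y₀+q₁} - (1-a_k)^{x₁} ω_k^{y₀})`,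
`x₁ = w₁'+1`, `x₁' = (r₁' - a₁ - w₁') + k + a₂`. [cite: DKLM2026SixVertexGFF, Theorem 23] -/
theorem cylinderPairExp_lPairObs_vertObs_eq_sum {r₁' r₂' : ℕ} (a₁ w₁' : ℕ) (h₁ : a₁ + w₁' + 1 ≤ r₁' + 1)
    (q₁ : ℕ) (a₂ : ℕ) (h₂ : a₂ + 0 + 1 ≤ r₂' + 1) (q₂ : ℕ) (y₀ y₂ k : ℕ) :
    ((cylinderPairExp c r₁' (lPairObs r₁' a₁ w₁' h₁ q₁ ((y₀ : ℕ) : ZMod (2 * (ℓ + 1)))) (r₁' + 1 + k) r₂'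
        (vertObs r₂' a₂ h₂ q₂ ((y₂ : ℕ) : ZMod (2 * (ℓ + 1)))) : ℝ) : ℂ) =
      ∑ j, (dklmWeight c hc ℓ j : ℂ) *
        (star (transferJointPhase c ℓ j) ^ (y₂ + q₂) - star (transferJointPhase c ℓ j) ^ y₂) *
        (1 - (dklmAtomA c ℓ j : ℂ)) ^ ((r₁' - a₁ - w₁') + k + a₂) *
        (transferJointPhase c ℓ j ^ (y₀ + q₁) - (1 - (dklmAtomA c ℓ j : ℂ)) ^ (w₁' + 1) * transferJointPhase c ℓ j ^ y₀) := by
  rw [vertObs, natCast_add_nsmul_one, cylinderPairExp_sub_right c hc, Complex.ofReal_sub,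
    cylinderPairExp_lPairObs_lPairObs_eq_sum c hc ℓ, cylinderPairExp_lPairObs_lPairObs_eq_sum c hc ℓ,
    ← Finset.sum_sub_distrib]
  refine Finset.sum_congr rfl fun j _ => ?_
  simp only [add_zero, zero_add, pow_one]
  ring

/-- **Theorem 23, both pairs vertical, gap `x₁' = (r₁' - s₁) + k + a₂ ≥ 0`** (spectral sum):
`Φ = ∑_k w_k (ω̄_k^{y₂+q₂} - ω̄_k^{y₂}) (1-a_k)^{x₁'} (ω_k^{y₀+q₁} - ω_k^{y₀})`.
[cite: DKLM2026SixVertexGFF, Theorem 23] -/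
theorem cylinderPairExp_colObs_vertObs_eq_sum {r₁' r₂' : ℕ} (s₁ : Fin (r₁' + 1)) (q₁ : ℕ) (a₂ : ℕ)
    (h₂ : a₂ + 0 + 1 ≤ r₂' + 1) (q₂ : ℕ) (y₀ y₂ k : ℕ) :
    ((cylinderPairExp c r₁' (colObs r₁' s₁ q₁ ((y₀ : ℕ) : ZMod (2 * (ℓ + 1)))) (r₁' + 1 + k) r₂'
        (vertObs r₂' a₂ h₂ q₂ ((y₂ : ℕ) : ZMod (2 * (ℓ + 1)))) : ℝ) : ℂ) =
      ∑ j, (dklmWeight c hc ℓ j : ℂ) *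
        (star (transferJointPhase c ℓ j) ^ (y₂ + q₂) - star (transferJointPhase c ℓ j) ^ y₂) *
        (1 - (dklmAtomA c ℓ j : ℂ)) ^ ((r₁' - s₁) + k + a₂) *
        (transferJointPhase c ℓ j ^ (y₀ + q₁) - transferJointPhase c ℓ j ^ y₀) := by
  rw [colObs_eq_lPairObs_sub, cylinderPairExp_sub_left c hc, Complex.ofReal_sub,
    cylinderPairExp_lPairObs_vertObs_eq_sum c hc ℓ, cylinderPairExp_lPairObs_vertObs_eq_sum c hc ℓ,
    ← Finset.sum_sub_distrib]
  refine Finset.sum_congr rfl fun j _ => ?_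
  simp only [Nat.sub_zero, add_zero, zero_add, pow_one]
  ring

/-- **Theorem 23, eq. (eq:thm23), pair 1 L-shaped and pair 2 vertical at gap `x₁' ≥ 0`:**
`Φ = ∫ χ^discr dμ_L` with `x₁ = w₁'+1`, `y₁ = q₁`, `x₁' = (r₁' - a₁ - w₁') + k + a₂`, `y₁' = y₂ - y₀ - q₁`,
`x₂ = 0`, `y₂ ↦ q₂`. [cite: DKLM2026SixVertexGFF, Theorem 23] -/
theorem cylinderPairExp_lPairObs_vertObs_eq_integral {r₁' r₂' : ℕ} (a₁ w₁' : ℕ) (h₁ : a₁ + w₁' + 1 ≤ r₁' + 1)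
    (q₁ : ℕ) (a₂ : ℕ) (h₂ : a₂ + 0 + 1 ≤ r₂' + 1) (q₂ : ℕ) (y₀ y₂ k : ℕ) :
    ((cylinderPairExp c r₁' (lPairObs r₁' a₁ w₁' h₁ q₁ ((y₀ : ℕ) : ZMod (2 * (ℓ + 1)))) (r₁' + 1 + k) r₂'
        (vertObs r₂' a₂ h₂ q₂ ((y₂ : ℕ) : ZMod (2 * (ℓ + 1)))) : ℝ) : ℂ) =
      ∫ p, chiDiscr (w₁' + 1) q₁ ((r₁' - a₁ - w₁') + k + a₂) ((y₂ : ℤ) - y₀ - q₁) 0 q₂ p ∂dklmMeasure c hc ℓ := by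
  refine ofReal_eq_integral_dklmMeasure c hc ℓ (fun a b => conj_chiDiscr _ _ _ _ _ _ a b) ?_
  rw [cylinderPairExp_lPairObs_vertObs_eq_sum c hc ℓ]
  refine Finset.sum_congr rfl fun j _ => ?_
  rw [← spectralTerm_eq_chiDiscr]
  ring

/-- **Theorem 23, eq. (eq:thm23), both pairs vertical at gap `x₁' ≥ 0`:** `y₁ = q₁`,
`x₁' = (r₁' - s₁) + k + a₂`, `y₁' = y₂ - y₀ - q₁`, `x₁ = x₂ = 0`, `y₂ ↦ q₂`.
[cite: DKLM2026SixVertexGFF, Theorem 23] -/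
theorem cylinderPairExp_colObs_vertObs_eq_integral {r₁' r₂' : ℕ} (s₁ : Fin (r₁' + 1)) (q₁ : ℕ) (a₂ : ℕ)
    (h₂ : a₂ + 0 + 1 ≤ r₂' + 1) (q₂ : ℕ) (y₀ y₂ k : ℕ) :
    ((cylinderPairExp c r₁' (colObs r₁' s₁ q₁ ((y₀ : ℕ) : ZMod (2 * (ℓ + 1)))) (r₁' + 1 + k) r₂'
        (vertObs r₂' a₂ h₂ q₂ ((y₂ : ℕ) : ZMod (2 * (ℓ + 1)))) : ℝ) : ℂ) =
      ∫ p, chiDiscr 0 q₁ ((r₁' - s₁) + k + a₂) ((y₂ : ℤ) - y₀ - q₁) 0 q₂ p ∂dklmMeasure c hc ℓ := by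
  refine ofReal_eq_integral_dklmMeasure c hc ℓ (fun a b => conj_chiDiscr _ _ _ _ _ _ a b) ?_
  rw [cylinderPairExp_colObs_vertObs_eq_sum c hc ℓ]
  refine Finset.sum_congr rfl fun j _ => ?_
  rw [← spectralTerm_eq_chiDiscr]
  ring

end Formula

end Literature.Probability.LatticeModels.SixVertex

end
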